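import Literature.Computability.Complexity.SearchToDecision
import Literature.Computability.Complexity.CodeFPArith
import Literature.Computability.Complexity.LengthCompare
import HarnessLib

/-!
# Bounded quantifiers and canonical witness search on codes, under `NP ⊆ P` (tools for THEOREM E♯)

Support file for the kernel form of THEOREM E♯ of the solo report (under `NP ⊆ P` every language
of `P` has a ONE-machine polynomial-time one-pass streaming algorithm whose state is within
`O(log N)` bits of the logarithm of its Myhill–Nerode class count).  The construction there
defines its maps (class representatives, separating hash families, codes of classes) by bounded
quantification over polynomial-time predicates and by witness search; this file packages the two
moves in the `CodeFP` calculus of the tree (`Literature.Computability.Complexity.CodeFP`):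

* `Collapse.exists_lang` — a polynomial-time Boolean test `p` on codes cuts out a language of `P`
  agreeing with `p` on codes;
* `Collapse.polyExists`, `Collapse.polyForall` — under `NP ⊆ P`, the bounded quantifications
  `a ↦ [∃ y, |y| ≤ q |⌜a⌝| ∧ p(a, y)]` and `a ↦ [∀ y, |y| ≤ q |⌜a⌝| → p(a, y)]` of a
  polynomial-time test `p` are again polynomial-time tests on codes (`NP = ∃·P`, Arora–Barak
  Def. 2.1, and `co P = P`);
* `Collapse.searchFn_eq_of_fibre` — the tree's search function `searchFn R q` (Arora–Barak
  Thm. 2.18, `SearchToDecision.lean`) is CANONICAL: its value on `x` depends only on `|x|` and on the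
  fibre `{y | ⟨x, y⟩ ∈ R}` (the rounds branch on membership queries about the fibre only);
* `Collapse.search` — under `NP ⊆ P`, for a polynomial-time test `p` there is a polynomial-time map
  `g` on codes returning a witness `p(a, g a)` within the length bound whenever one exists, with
  `g a = g a'` whenever `⌜a⌝, ⌜a'⌝` have the same length and the same fibre;
* `Collapse.indicator` — the indicator of a language of `P` as a test on codes.

All statements proved; the only hypothesis is `NP ⊆ P` where stated.

References: S. Arora, B. Barak, *Computational Complexity: A Modern Approach*, CUP 2009, Def. 2.1,
Thm. 2.18, Def. 5.3 (`Σₖ` by bounded quantifiers); L. Stockmeyer, *The polynomial-time hierarchy*,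
TCS 3 (1976) 1–22, Thm. 3.1 (quantifier characterisation).
-/

namespace Summit.PneNP.PneNP.Theorems.SoloBlind

open Computability Polynomial
open Literature.Computability.Complexity
open Literature.Computability.Complexity.CodeFP (bitE pairE strE)

namespace Collapse

variable {α : Type} {eα : α → List Bool}

/-- The pair code of `(a, y)` with a raw string in the second slot. [folklore] -/
theorem pairE_strE_apply (a : α) (y : List Bool) :
    pairE eα strE (a, y) = boolPair (eα a) y := rfl

/-- **A polynomial-time test on codes cuts out a language of `P`** agreeing with the test on codes
(off the codes the language is whatever the test machine says). [cite: AroraBarak2009, Def. 1.13] -/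
theorem exists_lang {p : α → Bool} (hp : CodeFP eα bitE p) :
    ∃ K : Language Bool, K ∈ Classes.P ∧ ∀ a, eα a ∈ K ↔ p a = true := by
  obtain ⟨f, hf, hfp⟩ := hp
  have hstr : CodeFP strE strE f := CodeFP.of_fn (eα := strE) (eβ := strE) f hf fun _ => rfl
  have htest : CodeFP strE bitE (fun w => decide (f w = [true])) :=
    (CodeFP.eq (eα := strE) Function.injective_id).comp (hstr.pair (CodeFP.const strE [true]))
  obtain ⟨g, hg, hgw⟩ := htest
  have hg1 : ∀ w, g w = [decide (f w = [true])] := fun w => hgw w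
  refine ⟨{w | f w = [true]}, mem_P_of_mem_FP hg _ (fun w => ⟨fun hw => ?_, fun hw => ?_⟩),
    fun a => ?_⟩
  · have hw' : f w = [true] := hw
    rw [hg1, decide_eq_true hw']
  · have hw' : ¬ f w = [true] := hw
    rw [hg1, decide_eq_false hw']
  · show f (eα a) = [true] ↔ p a = true
    rw [hfp a]
    show [p a] = [true] ↔ p a = true
    simp

/-- **The indicator of a language of `P` is a polynomial-time test on codes.**
[cite: AroraBarak2009, Def. 1.13] -/
theorem indicator {L : Language Bool} (hL : L ∈ Classes.P) :
    CodeFP strE bitE (fun x => L.boolIndicator x) :=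
  CodeFP.of_fn _ (indicatorFn_mem_FP hL) fun x => by
    show encodeBool (L.boolIndicator x) = [L.boolIndicator x]
    cases L.boolIndicator x <;> rfl

open scoped Classical in
/-- **Bounded existential quantification under the collapse.** If `NP ⊆ P` and `p` is a
polynomial-time test on pair codes `⟨⌜a⌝, y⟩`, then `a ↦ [∃ y, |y| ≤ q(|⌜a⌝|) ∧ p(a, y)]` is a
polynomial-time test on codes (the projected language is in `NP = ∃·P ⊆ P`).
[cite: AroraBarak2009, Def. 2.1] -/
theorem polyExists (hNP : Nondeterministic.NP ⊆ Classes.P) {p : α × List Bool → Bool}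
    (hp : CodeFP (pairE eα strE) bitE p) (q : Polynomial ℕ) :
    CodeFP eα bitE (fun a => decide (∃ y : List Bool,
      y.length ≤ q.eval (eα a).length ∧ p (a, y) = true)) := by
  obtain ⟨R, hR, hRa⟩ := exists_lang hp
  set K : Language Bool :=
    {x | ∃ y : List Bool, y.length ≤ q.eval x.length ∧ boolPair x y ∈ R} with hKdef
  have hK : K ∈ Nondeterministic.NP := ⟨R, hR, q, fun x => Iff.rfl⟩
  have hKP : K ∈ Classes.P := hNP hK
  refine CodeFP.of_fn (fun x => encodeBool (K.boolIndicator x)) (indicatorFn_mem_FP hKP) fun a => ?_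
  show encodeBool (K.boolIndicator (eα a)) = [decide _]
  by_cases h : ∃ y : List Bool, y.length ≤ q.eval (eα a).length ∧ p (a, y) = true
  · have hmem : eα a ∈ K := by
      obtain ⟨y, hy, hpy⟩ := h
      exact ⟨y, hy, (hRa (a, y)).2 hpy⟩
    rw [(Set.mem_iff_boolIndicator _ _).1 hmem, decide_eq_true h]
    rfl
  · have hnm : eα a ∉ K := fun ⟨y, hy, hyR⟩ => h ⟨y, hy, (hRa (a, y)).1 hyR⟩
    rw [(Set.notMem_iff_boolIndicator _ _).1 hnm, decide_eq_false h]
    rfl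

open scoped Classical in
/-- **Bounded universal quantification under the collapse** (`co P = P` around `polyExists`).
[cite: AroraBarak2009, Def. 2.1; Def. 5.3] -/
theorem polyForall (hNP : Nondeterministic.NP ⊆ Classes.P) {p : α × List Bool → Bool}
    (hp : CodeFP (pairE eα strE) bitE p) (q : Polynomial ℕ) :
    CodeFP eα bitE (fun a => decide (∀ y : List Bool,
      y.length ≤ q.eval (eα a).length → p (a, y) = true)) := by
  refine ((polyExists hNP hp.not q).not).congr fun a => ?_
  show (!decide (∃ y : List Bool, y.length ≤ q.eval (eα a).length ∧ (!p (a, y)) = true)) =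
    decide (∀ y : List Bool, y.length ≤ q.eval (eα a).length → p (a, y) = true)
  by_cases h : ∀ y : List Bool, y.length ≤ q.eval (eα a).length → p (a, y) = true
  · have hne : ¬ ∃ y : List Bool, y.length ≤ q.eval (eα a).length ∧ (!p (a, y)) = true := by
      rintro ⟨y, hy, hny⟩
      have := h y hy
      rw [this] at hny
      exact Bool.false_ne_true hny
    rw [decide_eq_false hne, decide_eq_true h]
    rfl
  · have hex : ∃ y : List Bool, y.length ≤ q.eval (eα a).length ∧ (!p (a, y)) = true := by
      obtain ⟨y, hy⟩ := not_forall.1 h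
      obtain ⟨hyl, hpy⟩ := Classical.not_imp.1 hy
      refine ⟨y, hyl, ?_⟩
      cases hpa : p (a, y)
      · rfl
      · exact absurd hpa hpy
    rw [decide_eq_true hex, decide_eq_false h]
    rfl

/-- **The tree's search function is canonical on fibres.** If `|x| = |x'|` and the fibres
`{y | ⟨x, y⟩ ∈ R}` and `{y | ⟨x', y⟩ ∈ R}` coincide, then `searchFn R q x = searchFn R q x'`: every
round (`roundFn_boolPair`) branches only on the queries `⟨x, w⟩ ∈ R` and `⟨x, 0w⟩ ∈ SuffExt R q`,
which are fibre questions. [cite: AroraBarak2009, Thm. 2.18 (proof)] -/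
theorem searchFn_eq_of_fibre (R : Language Bool) (q : Polynomial ℕ) {x x' : List Bool}
    (hlen : x.length = x'.length) (hfib : ∀ y, boolPair x y ∈ R ↔ boolPair x' y ∈ R) :
    searchFn R q x = searchFn R q x' := by
  classical
  have key : ∀ k, ∃ w, (roundFn R q)^[k] (boolPair x []) = boolPair x w ∧
      (roundFn R q)^[k] (boolPair x' []) = boolPair x' w := by
    intro k
    induction k with
    | zero => exact ⟨[], rfl, rfl⟩
    | succ k ih =>
      obtain ⟨w, h1, h2⟩ := ih
      rw [Function.iterate_succ_apply', Function.iterate_succ_apply', h1, h2,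
        roundFn_boolPair R q x w, roundFn_boolPair R q x' w]
      have e1 : boolPair x w ∈ R ↔ boolPair x' w ∈ R := hfib w
      have e2 : boolPair x (false :: w) ∈ SuffExt R q ↔
          boolPair x' (false :: w) ∈ SuffExt R q := by
        rw [boolPair_mem_SuffExt, boolPair_mem_SuffExt, hlen]
        exact exists_congr fun v => and_congr Iff.rfl (hfib _)
      by_cases hR1 : boolPair x w ∈ R
      · rw [if_pos hR1, if_pos (e1.1 hR1)]
        exact ⟨w, rfl, rfl⟩
      · rw [if_neg hR1, if_neg (fun h => hR1 (e1.2 h))]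
        by_cases hS : boolPair x (false :: w) ∈ SuffExt R q
        · rw [if_pos hS, if_pos (e2.1 hS)]
          exact ⟨_, rfl, rfl⟩
        · rw [if_neg hS, if_neg (fun h => hS (e2.2 h))]
          exact ⟨_, rfl, rfl⟩
  obtain ⟨w, h1, h2⟩ := key (q.eval x.length)
  simp only [searchFn, Function.comp_apply, boolUnpair_boolPair]
  rw [h1, ← hlen, h2, boolUnpair_boolPair, boolUnpair_boolPair]

/-- **Canonical witness search under the collapse.** If `NP ⊆ P` and `p` is a polynomial-time test
on pair codes, there is a polynomial-time map `g` on codes such that (i) whenever some `y` with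
`|y| ≤ q(|⌜a⌝|)` has `p(a, y)`, `g a` is such a `y`; (ii) `g a = g a'` whenever `⌜a⌝` and `⌜a'⌝`
have the same length and `p(a, ·) = p(a', ·)` (canonicity).
[cite: AroraBarak2009, Thm. 2.18] -/
theorem search (hNP : Nondeterministic.NP ⊆ Classes.P) {p : α × List Bool → Bool}
    (hp : CodeFP (pairE eα strE) bitE p) (q : Polynomial ℕ) :
    ∃ g : α → List Bool, CodeFP eα strE g ∧
      (∀ a, (∃ y : List Bool, y.length ≤ q.eval (eα a).length ∧ p (a, y) = true) →
        (g a).length ≤ q.eval (eα a).length ∧ p (a, g a) = true) ∧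
      (∀ a a', (eα a).length = (eα a').length → (∀ y, p (a, y) = p (a', y)) → g a = g a') := by
  obtain ⟨R, hR, hRa⟩ := exists_lang hp
  have hE : SuffExt R q ∈ Classes.P := hNP (SuffExt_mem_NP R q hR)
  refine ⟨fun a => searchFn R q (eα a),
    CodeFP.of_fn (searchFn R q) (searchFn_mem_FP R q hR hE) (fun _ => rfl), fun a ha => ?_,
    fun a a' hlen hfib => ?_⟩
  · have hx : ∃ y : List Bool, y.length ≤ q.eval (eα a).length ∧ boolPair (eα a) y ∈ R := by
      obtain ⟨y, hy, hpy⟩ := ha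
      exact ⟨y, hy, (hRa (a, y)).2 hpy⟩
    obtain ⟨hl, hmem⟩ := searchFn_spec R q (eα a) hx
    exact ⟨hl, (hRa (a, _)).1 hmem⟩
  · refine searchFn_eq_of_fibre R q hlen fun y => ?_
    have h1 := hRa (a, y)
    have h2 := hRa (a', y)
    rw [pairE_strE_apply] at h1 h2
    rw [h1, h2, hfib y]

end Collapse

end Summit.PneNP.PneNP.Theorems.SoloBlind
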